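import Literature.NumberTheory.Transcendental.PhilipponCriterionProjDist
import Literature.NumberTheory.Transcendental.AnalytificationProperProofs
import Literature.RingTheory.KrullDimension.BaseChangeDimension
import Literature.Barriers.Schanuel.NesterenkoModularScopeMeasureClaim
import Mathlib.RingTheory.Ideal.GoingDown
import Mathlib.RingTheory.Flat.Stability
import Mathlib.RingTheory.TensorProduct.MvPolynomial
import Mathlib.RingTheory.KrullDimension.Polynomial
import Mathlib.FieldTheory.IntermediateField.Adjoin.Basic
import HarnessLib

/-!
# Positive-dimensional projective varieties over `ℚ` have no isolated complex points — proofs only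

`Literature/NumberTheory/Transcendental/ProjectiveNoIsolatedPoints.lean` — proofs only (no new
definitions, nothing asserted). The topological input of Philippon's criterion for algebraic
independence (Publ. Math. IHÉS 64 (1986), Thm 2.11 = the named fact `Philippon1986_mainCriterion`;
used silently in §3, proof of Lemme 2.14, p. 43): *a projective variety of dimension `≥ 1` meeting an
open ball has infinitely many points in it*, i.e. Mumford, *Algebraic Geometry I*, Thm (2.33) (the
classical closure of a non-empty Zariski-open subset of a variety is the variety) applied to the
complement of a point.

Here it is PROVED, for the zero sets `V(𝔭) ⊂ ℙ^m(ℂ)` (`Nesterenko.projZeros`) of homogeneous prime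
ideals `𝔭 ⊂ ℚ[x₀, …, x_m]` of projective dimension `r − 1 ≥ 1` (`Nesterenko.IsUnmixedOfRank 𝔭 r`,
`2 ≤ r`), in the affine chart `x₀ ≠ 0` with the max norm
(`infinite_projZeros_near`): every polydisc about a point `(1 : c)` of `V(𝔭)` contains infinitely
many points `(1 : z)` of `V(𝔭)`. The analytic heart is the tree's density theorem in coordinates
`Literature.NumberTheory.Transcendental.AlgHomClosure.mem_closure_setOf_le_ker_aeval`
(`AnalytificationProperProofs.lean`; SGA 1 XII Prop. 2.2 / Serre GAGA §2 n°7: for a prime `P` of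
`k[x]`, `k ⊆ ℂ` any field, `f ∉ P` and a complex zero `w₀` of `P`, the complex zeros `w` of `P` with
`f(w) ≠ 0` accumulate at `w₀`), which we apply over the field of definition `k = ℚ(c)` of the point,
where `w₀ = (1, c)` is rational: if `P` is a minimal prime of `𝔭·k[x]` below the maximal ideal of
`w₀`, then `dim k[x] ⧸ P = dim ℚ[x] ⧸ 𝔭 = r ≥ 2` (the components of a base change have the
dimension of the variety, `Literature.RingTheory.KrullDimension.ringKrullDim_quotient_eq_of_isPushout_of_mem_minimalPrimes`,
Zariski–Samuel II Ch. VII §11 Thm 36 Cor. 1, after identifying `P ∩ ℚ[x] = 𝔭` by going down for the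
flat extension `ℚ[x] → k[x]`), so `P` does not contain the ideal of the line `ℂ·w₀` (whose
quotient `≅ k[t]` has dimension `1`); a polynomial `f` of that ideal outside `P` vanishes on the
line, hence the zeros `w` of `P` with `f(w) ≠ 0` accumulating at `w₀` normalise (`V(𝔭)` is a cone)
to points `(1 : z) ∈ V(𝔭)` with `z ≠ c`, `z → c` — infinitely many in every polydisc.

## References

* [Mumford1981] D. Mumford, *Algebraic Geometry I: Complex Projective Varieties*, Thm (2.33), p. 37.
* [ZariskiSamuel1960] O. Zariski, P. Samuel, *Commutative Algebra* II, Ch. VII §11, Thm 36, Cor. 1.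
* [Philippon1986Criteres] P. Philippon, Publ. Math. IHÉS 64 (1986), §3, p. 43 (the use).
-/

noncomputable section

open MvPolynomial
open Literature.NumberTheory.Transcendental.Nesterenko

namespace Literature.NumberTheory.Transcendental

namespace PhilipponMain

universe u

/-! ### Rank of a prime ideal -/

/-- For a PRIME ideal, `IsUnmixedOfRank 𝔭 r` says `dim ℚ[x̲] ⧸ 𝔭 = r` (`𝔭` is its own, only,
associated prime). [folklore] -/
theorem ringKrullDim_quotient_eq_of_isUnmixedOfRank {m r : ℕ} {𝔭 : Ideal (Rx m)} (h𝔭 : 𝔭.IsPrime)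
    (hunm : IsUnmixedOfRank 𝔭 r) : ringKrullDim (Rx m ⧸ 𝔭) = r := by
  classical
  apply hunm.2
  rw [← (Literature.Barriers.Schanuel.isMinimalPrimaryDecomposition_singleton
    h𝔭).image_radical_eq_associated_primes]
  refine ⟨𝔭, Finset.mem_singleton_self _, ?_⟩
  simp only
  rw [Submodule.colon_univ, h𝔭.radical]

/-! ### Base change of a prime of `ℚ[x̲]` to a field of definition of a point -/

section BaseChange

variable {K : Type} [Field K] [Algebra ℚ K] {m : ℕ}

/-- `K[x̲]` is flat over `ℚ[x̲]` (it is `ℚ[x̲] ⊗_ℚ K`). [folklore] -/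
theorem flat_mvPolynomial_baseChange :
    letI : Algebra (Rx m) (MvPolynomial (Fin (m + 1)) K) := MvPolynomial.algebraMvPolynomial
    Module.Flat (Rx m) (MvPolynomial (Fin (m + 1)) K) := by
  letI : Algebra (Rx m) (MvPolynomial (Fin (m + 1)) K) := MvPolynomial.algebraMvPolynomial
  exact Module.Flat.of_linearEquiv
    (Algebra.IsPushout.equiv ℚ (Rx m) K (MvPolynomial (Fin (m + 1)) K)).symm.toLinearEquiv

/-- **Minimal primes of a base change contract to the prime and keep its dimension.** For a prime
`𝔭 ⊂ ℚ[x̲]` with `dim ℚ[x̲] ⧸ 𝔭 = r` and a minimal prime `P` of `𝔭·K[x̲]`: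
`dim K[x̲] ⧸ P = r` (going down for the flat extension gives `P ∩ ℚ[x̲] = 𝔭`, then
`ringKrullDim_quotient_eq_of_isPushout_of_mem_minimalPrimes`).
[cite: ZariskiSamuel1960, Ch. VII §11 Thm 36 and Cor. 1] -/
theorem ringKrullDim_quotient_eq_of_mem_minimalPrimes_map {𝔭 : Ideal (Rx m)} (h𝔭 : 𝔭.IsPrime)
    {r : ℕ} (hdim : ringKrullDim (Rx m ⧸ 𝔭) = r) {P : Ideal (MvPolynomial (Fin (m + 1)) K)}
    (hP : P ∈ (𝔭.map (MvPolynomial.map (algebraMap ℚ K))).minimalPrimes) :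
    ringKrullDim (MvPolynomial (Fin (m + 1)) K ⧸ P) = r := by
  letI : Algebra (Rx m) (MvPolynomial (Fin (m + 1)) K) := MvPolynomial.algebraMvPolynomial
  haveI : Module.Flat (Rx m) (MvPolynomial (Fin (m + 1)) K) := flat_mvPolynomial_baseChange
  set R' := MvPolynomial (Fin (m + 1)) K
  have halg : algebraMap (Rx m) R' = MvPolynomial.map (algebraMap ℚ K) := MvPolynomial.algebraMap_def
  haveI hPprime : P.IsPrime := hP.1.1
  have hI'P : 𝔭.map (algebraMap (Rx m) R') ≤ P := by rw [halg]; exact hP.1.2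
  have h1 : 𝔭 ≤ P.under (Rx m) := fun g hg => hI'P (Ideal.mem_map_of_mem _ hg)
  -- going down: `P ∩ ℚ[x̲] = 𝔭`
  haveI := h𝔭
  haveI : P.LiesOver (P.under (Rx m)) := ⟨rfl⟩
  have hunder : P.under (Rx m) = 𝔭 := by
    obtain ⟨P₀, hP₀P, hP₀prime, hP₀over⟩ :=
      Ideal.exists_ideal_le_liesOver_of_le (p := 𝔭) (q := P.under (Rx m)) P h1
    have hI'P₀ : 𝔭.map (MvPolynomial.map (algebraMap ℚ K)) ≤ P₀ := by
      rw [← halg, Ideal.map_le_iff_le_comap, hP₀over.over]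
    have hPP₀ : P ≤ P₀ := hP.2 ⟨hP₀prime, hI'P₀⟩ hP₀P
    have hEq : P = P₀ := le_antisymm hPP₀ hP₀P
    rw [hEq]
    exact hP₀over.over.symm
  have hmin : P ∈ ((P.under (Rx m)).map (algebraMap (Rx m) R')).minimalPrimes := by
    rw [hunder, halg]; exact hP
  rw [Literature.RingTheory.KrullDimension.ringKrullDim_quotient_eq_of_isPushout_of_mem_minimalPrimes
      (k := ℚ) (L := K) (R := Rx m) (R' := R') P hmin, hunder, hdim]

end BaseChange

/-! ### The main theorem -/

/-- **A positive-dimensional `ℚ`-variety in `ℙ^m` has no isolated complex points** (Mumford,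
*Algebraic Geometry I*, Thm (2.33), via the tree's density theorem
`AlgHomClosure.mem_closure_setOf_le_ker_aeval` over the field of definition `ℚ(c)` of the point and
base change, see the module docstring). For a homogeneous prime `𝔭 ⊂ ℚ[x₀, …, x_m]` (homogeneity in
the form: `𝔭` contains the homogeneous components of its elements) with `dim 𝔭 = r − 1 ≥ 1`, a point
`c ∈ ℂ^m` with `(1, c) ∈ V(𝔭)` and `ε > 0`, the set of `z ∈ ℂ^m` with `(1, z) ∈ V(𝔭)` and
`max_i |z_i − c_i| < ε` is infinite. [cite: Mumford1981, Ch. 2 Theorem (2.33) (p. 37)] -/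
theorem infinite_projZeros_near {m r : ℕ} {𝔭 : Ideal (Rx m)} (hr : 2 ≤ r) (h𝔭 : 𝔭.IsPrime)
    (hhom : ∀ g ∈ 𝔭, ∀ k : ℕ, homogeneousComponent k g ∈ 𝔭) (hunm : IsUnmixedOfRank 𝔭 r)
    {c : Fin m → ℂ} (hc : (Fin.cons 1 c : Fin (m + 1) → ℂ) ∈ projZeros 𝔭) {ε : ℝ} (hε : 0 < ε) :
    Set.Infinite {z : Fin m → ℂ |
      (Fin.cons 1 z : Fin (m + 1) → ℂ) ∈ projZeros 𝔭 ∧ ∀ i, ‖z i - c i‖ < ε} := by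
  classical
  set w₀ : Fin (m + 1) → ℂ := Fin.cons 1 c with hw₀def
  -- the field of definition `K = ℚ(c)` of the point, over which `w₀` is rational
  set K : IntermediateField ℚ ℂ := IntermediateField.adjoin ℚ (Set.range c) with hKdef
  have hcK : ∀ j, c j ∈ K := fun j => IntermediateField.subset_adjoin ℚ _ ⟨j, rfl⟩
  set c' : Fin m → K := fun j => ⟨c j, hcK j⟩ with hc'def
  have hc'c : ∀ j, (algebraMap K ℂ) (c' j) = c j := fun j => rfl
  set R' := MvPolynomial (Fin (m + 1)) K with hR'def
  -- the maximal ideal of `w₀` in `K[x̲]` contains `𝔭·K[x̲]`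
  set 𝔪 : Ideal R' := RingHom.ker (MvPolynomial.aeval w₀ : R' →ₐ[K] ℂ) with h𝔪def
  haveI h𝔪 : 𝔪.IsPrime := RingHom.ker_isPrime _
  set I' : Ideal R' := 𝔭.map (MvPolynomial.map (algebraMap ℚ K)) with hI'def
  have hI'𝔪 : I' ≤ 𝔪 := by
    rw [hI'def, Ideal.map_le_iff_le_comap]
    intro g hg
    rw [Ideal.mem_comap, h𝔪def, RingHom.mem_ker]
    show MvPolynomial.aeval w₀ (MvPolynomial.map (algebraMap ℚ K) g) = 0
    rw [MvPolynomial.aeval_map_algebraMap]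
    exact hc.2 g hg
  -- a minimal prime `P` of `𝔭·K[x̲]` inside `𝔪`, of dimension `r`
  obtain ⟨P, hPmin, hP𝔪⟩ := Ideal.exists_minimalPrimes_le hI'𝔪
  haveI hPprime : P.IsPrime := hPmin.1.1
  have hI'P : I' ≤ P := hPmin.1.2
  have hdimP : ringKrullDim (R' ⧸ P) = r :=
    ringKrullDim_quotient_eq_of_mem_minimalPrimes_map h𝔭
      (ringKrullDim_quotient_eq_of_isUnmixedOfRank h𝔭 hunm) hPmin
  -- the line `ℂ · w₀`: `φ : K[x̲] → K[t]`, `x₀ ↦ t`, `x_{j+1} ↦ c_j t`, surjective, so its kernel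
  -- has a quotient of dimension `1 < r` and is not contained in `P`
  let ℓ : Fin (m + 1) → Polynomial K :=
    Fin.cons Polynomial.X (fun j => Polynomial.C (c' j) * Polynomial.X)
  let φ : R' →ₐ[K] Polynomial K := MvPolynomial.aeval ℓ
  have hφsurj : Function.Surjective φ := fun q => by
    refine ⟨Polynomial.aeval (X 0 : R') q, ?_⟩
    show φ (Polynomial.aeval (X 0 : R') q) = q
    rw [← Polynomial.aeval_algHom_apply]
    have hφ0 : φ (X 0) = Polynomial.X := by
      show MvPolynomial.aeval ℓ (X 0) = Polynomial.X
      rw [MvPolynomial.aeval_X]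
      rfl
    rw [hφ0, Polynomial.aeval_X_left_apply]
  have hnot : ¬ (RingHom.ker φ ≤ P) := by
    intro hle
    have h1 : ringKrullDim (R' ⧸ P) ≤ ringKrullDim (R' ⧸ RingHom.ker φ) :=
      ringKrullDim_le_of_surjective (Ideal.Quotient.factor hle) (Ideal.Quotient.factor_surjective hle)
    have h2 : ringKrullDim (R' ⧸ RingHom.ker φ) = ringKrullDim (Polynomial K) :=
      ringKrullDim_eq_of_ringEquiv (RingHom.quotientKerEquivOfSurjective hφsurj)
    have h3 : ringKrullDim (Polynomial K) = 1 := by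
      rw [Polynomial.ringKrullDim_of_isNoetherianRing, ringKrullDim_eq_zero_of_field, zero_add]
    rw [hdimP, h2, h3] at h1
    have h4 : (r : WithBot ℕ∞) ≤ ((1 : ℕ) : WithBot ℕ∞) := by simpa using h1
    have h5 : r ≤ 1 := by exact_mod_cast h4
    omega
  obtain ⟨f, hfℓ, hfP⟩ := Set.not_subset.mp hnot
  have hφf : φ f = 0 := hfℓ
  -- `f` vanishes on the line
  have hf_line : ∀ s : ℂ, MvPolynomial.aeval (s • w₀) f = 0 := by
    intro s
    have heq : (MvPolynomial.aeval (s • w₀) : R' →ₐ[K] ℂ) = (Polynomial.aeval s).comp φ := by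
      refine MvPolynomial.algHom_ext fun i => ?_
      refine Fin.cases ?_ (fun j => ?_) i
      · simp [φ, ℓ, hw₀def]
      · have lhs : (MvPolynomial.aeval (s • w₀) : R' →ₐ[K] ℂ) (X j.succ) = s * c j := by
          rw [MvPolynomial.aeval_X]; simp [hw₀def]
        have rhs : ((Polynomial.aeval s).comp φ) (X j.succ) = c j * s := by
          rw [AlgHom.comp_apply]
          show Polynomial.aeval s (MvPolynomial.aeval ℓ (X j.succ)) = c j * s
          rw [MvPolynomial.aeval_X]
          simp only [ℓ, Fin.cons_succ, map_mul, Polynomial.aeval_C, Polynomial.aeval_X, hc'c]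
        rw [lhs, rhs, mul_comm]
    rw [heq, AlgHom.comp_apply, hφf, map_zero]
  -- the density theorem over `K`: zeros of `P` with `f ≠ 0` accumulate at `w₀`
  have hclos := AlgHomClosure.mem_closure_setOf_le_ker_aeval (k := K) hfP hP𝔪
  -- suppose the polydisc contains only finitely many points of `V(𝔭)`
  by_contra hfin
  rw [Set.not_infinite] at hfin
  -- separation of its points other than `c` from `c`
  obtain ⟨δ₀, hδ₀, hsep⟩ : ∃ δ₀ : ℝ, 0 < δ₀ ∧ ∀ z ∈ {z : Fin m → ℂ |
      (Fin.cons 1 z : Fin (m + 1) → ℂ) ∈ projZeros 𝔭 ∧ ∀ i, ‖z i - c i‖ < ε}, z ≠ c → δ₀ ≤ ‖z - c‖ := by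
    set T := hfin.toFinset.filter (fun z => z ≠ c) with hT
    by_cases hTne : T.Nonempty
    · refine ⟨T.inf' hTne (fun z => ‖z - c‖), ?_, ?_⟩
      · rw [Finset.lt_inf'_iff]
        intro z hz
        exact norm_pos_iff.mpr (sub_ne_zero.mpr (Finset.mem_filter.mp hz).2)
      · intro z hzS hzc
        exact Finset.inf'_le _ (Finset.mem_filter.mpr ⟨hfin.mem_toFinset.mpr hzS, hzc⟩)
    · refine ⟨1, one_pos, fun z hzS hzc => ?_⟩
      exact absurd ⟨z, Finset.mem_filter.mpr ⟨hfin.mem_toFinset.mpr hzS, hzc⟩⟩ hTne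
  -- approximation scale
  set C : ℝ := ‖c‖ with hCdef
  have hC0 : 0 ≤ C := norm_nonneg _
  set η : ℝ := min ε δ₀ with hηdef
  have hη0 : 0 < η := lt_min hε hδ₀
  set ε' : ℝ := min (1 / 2) (η / (4 * (1 + C))) with hε'def
  have hε'pos : 0 < ε' := lt_min (by norm_num) (by positivity)
  have hε'half : ε' ≤ 1 / 2 := min_le_left _ _
  have hε'η : ε' ≤ η / (4 * (1 + C)) := min_le_right _ _
  obtain ⟨w, ⟨hwP, hwf⟩, hwdist⟩ := Metric.mem_closure_iff.mp hclos ε' hε'pos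
  have hwi : ∀ i, ‖w i - w₀ i‖ < ε' := fun i => by
    rw [← dist_eq_norm, dist_comm]
    exact lt_of_le_of_lt (dist_le_pi_dist w₀ w i) hwdist
  -- `w₀ = (1, c)`: the coordinates of `w`
  have hw0 : ‖w 0 - 1‖ < ε' := by simpa [hw₀def] using hwi 0
  have hwj : ∀ j : Fin m, ‖w j.succ - c j‖ < ε' := fun j => by simpa [hw₀def] using hwi j.succ
  have hw0ge : 1 / 2 ≤ ‖w 0‖ := by
    have h1 : ‖(1 : ℂ)‖ - ‖w 0‖ ≤ ‖1 - w 0‖ := norm_sub_norm_le _ _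
    rw [norm_one, norm_sub_rev] at h1
    linarith
  have hw0ne : w 0 ≠ 0 := by
    intro h; rw [h, norm_zero] at hw0ge; norm_num at hw0ge
  -- `w` is a (non-zero) complex zero of `𝔭`
  have hwzero : w ∈ projZeros 𝔭 := by
    refine ⟨fun h => hw0ne (by rw [h]; rfl), fun g hg => ?_⟩
    have h1 : MvPolynomial.map (algebraMap ℚ K) g ∈ P := hI'P (Ideal.mem_map_of_mem _ hg)
    have h2 := hwP h1
    rw [RingHom.mem_ker] at h2
    have h3 : (MvPolynomial.aeval w : R' →ₐ[K] ℂ) (MvPolynomial.map (algebraMap ℚ K) g) =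
        MvPolynomial.aeval w g := MvPolynomial.aeval_map_algebraMap _ _ _
    rw [← h3]
    exact h2
  -- its normalisation `(1 : z)` lies in `V(𝔭)` and in the polydisc
  set z : Fin m → ℂ := fun j => w j.succ / w 0 with hzdef
  have hzmem : (Fin.cons 1 z : Fin (m + 1) → ℂ) ∈ projZeros 𝔭 :=
    cons_one_div_mem_projZeros hhom hwzero hw0ne
  have hzj : ∀ j : Fin m, ‖z j - c j‖ < η := by
    intro j
    have hw0pos : 0 < ‖w 0‖ := by linarith
    have e : z j - c j = ((w j.succ - c j) - c j * (w 0 - 1)) / w 0 := by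
      simp only [hzdef]
      field_simp
      ring
    rw [e, norm_div, div_lt_iff₀ hw0pos]
    have h1 : ‖(w j.succ - c j) - c j * (w 0 - 1)‖ ≤ ε' + C * ε' := by
      refine (norm_sub_le _ _).trans (add_le_add (hwj j).le ?_)
      rw [norm_mul]
      exact mul_le_mul (norm_le_pi_norm c j) (hw0).le (norm_nonneg _) hC0
    have h2 : ε' + C * ε' = (1 + C) * ε' := by ring
    have h3 : (1 + C) * ε' ≤ η / 4 := by
      calc (1 + C) * ε' ≤ (1 + C) * (η / (4 * (1 + C))) :=
            mul_le_mul_of_nonneg_left hε'η (by positivity)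
        _ = η / 4 := by field_simp
    calc ‖(w j.succ - c j) - c j * (w 0 - 1)‖ ≤ η / 4 := by linarith
      _ < η * ‖w 0‖ := by nlinarith
  have hzS : z ∈ {z : Fin m → ℂ |
      (Fin.cons 1 z : Fin (m + 1) → ℂ) ∈ projZeros 𝔭 ∧ ∀ i, ‖z i - c i‖ < ε} :=
    ⟨hzmem, fun j => lt_of_lt_of_le (hzj j) (min_le_left _ _)⟩
  -- `z ≠ c`, for otherwise `w = w₀ • (1, c)` lies on the line, where `f` vanishes
  have hzne : z ≠ c := by
    intro hzc
    apply hwf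
    have hw : w = w 0 • w₀ := by
      funext i
      refine Fin.cases ?_ (fun j => ?_) i
      · simp [hw₀def]
      · have h1 : w j.succ / w 0 = c j := by
          have := congrFun hzc j
          simpa [hzdef] using this
        rw [div_eq_iff hw0ne] at h1
        simp [hw₀def, h1, mul_comm]
    rw [hw]
    exact hf_line (w 0)
  -- contradiction with the separation
  have hlt : ‖z - c‖ < δ₀ := by
    rw [pi_norm_lt_iff hδ₀]
    intro j
    simpa using lt_of_lt_of_le (hzj j) (min_le_right _ _)
  exact absurd (hsep z hzS hzne) (not_le.mpr hlt)

end PhilipponMain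

end Literature.NumberTheory.Transcendental

end
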